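import Mathlib

/-!
# Coin systems with arbitrary arc sets: the BASE row and the free-arc gate FAIL — two kernel-checked
witnesses fixing the scope of row 2′DARC (blind cell PercRepro2, night-2)

Row 2′DARC (CONJECTURES v2.99bf) is stated for «every coin system» — coins `c` with probability `p_c`
and an ARBITRARY arc set `Arcs(c) ⊆ V × V`, all arcs of an open coin being open.  Its census (lead,
engine D89, mine-c) runs on digraphs (one arc per coin) and mixed graphs (antiparallel pairs), and the
directed van den Berg–Kahn induction behind the BASE row needs exactly that: a coin with an arc INTO the
explored set must have no arc inside the unexplored part.  This file records, with `decide +kernel`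
(standard axioms only), that the generality «arbitrary arc sets» is FALSE:

* `base_fails`: four vertices `s = 0, a = 1, b = 2, t = 3`, coin `0 = {s→a, b→t}`, coin `1 = {s→b}`,
  both of probability `1/2`, `T = {t}`: `P(R) = 3/4`, `E[X;R] = E[Y;R] = 1/4`, `E[XY;R] = 0`, so
  `Cov(X, Y | s ↛ t) = −1/9` — directed BHK 1.3 (the BASE row, the case `u ∈ T` of 2′DARC) fails.
* `free_arc_fails`: six vertices, eight coins (four of them two-arc coins), weights `k/8`, `s = 4`,
  `T = {1}`, `a = 0`, `b = 3`, free arc `u = 2 → w = 5`: BASE HOLDS (`Φ(R) = 135/12928 > 0`) and the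
  gate functional is `Φ(E) = −98145/5222912 < 0` with `P(Q) = 81/512 > 0` — the free-arc statement
  itself fails on a system where the BASE row is fine.

Conventions (night-2, proofs/NIGHT2-DARC.md §0): `S⁺ = R(s)` the forward closure of `s`, `K⁻` the
backward closure of `T`, `R = {s ↛ T}`, `X = 1[a ∈ S⁺]`, `Y = 1[b ∈ S⁺]`, `m = E[· | R]`,
`Φ(𝒟) = E[(X − m_X)(Y − m_Y); 𝒟]`, `Q = {u ∈ S⁺ ∧ w ∈ K⁻} ∩ R` (the arc `u → w` is pivotal),
`E = R ∖ Q = {s ↛ T in D + (u → w)}`.  All masses are integers in units of `den^{-#coins}`; the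
inequalities are the cleared forms `Φ(R)·P(R) = E[XY;R]P(R) − E[X;R]E[Y;R]` and
`Φ(E)·P(R)² = E[XY;E]P(R)² − P(R)E[X;R]E[Y;E] − P(R)E[Y;R]E[X;E] + E[X;R]E[Y;R]P(E)`.
REPAIR of the row: restrict to MIXED coin systems (every coin a single arc or an antiparallel pair).
-/

namespace Summit.Ventures.PercRepro2.CoinScope

/-- A coin: weight `w` (open with probability `w / den`) and a list of arcs `(tail, head)`. -/
structure Coin where
  w : Nat
  arcs : List (Nat × Nat)

/-- Coin `i` is open in the configuration `c` iff bit `i` of `c` is set. -/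
def isOpen (c i : Nat) : Bool := c.testBit i

/-- `x ∈ S` for a bitmask `S`. -/
def mem (S x : Nat) : Bool := S.testBit x

/-- One forward expansion step of the vertex set `S` along the arcs of the open coins. -/
def step (coins : List Coin) (c : Nat) (S : Nat) : Nat :=
  (List.range coins.length).foldl (fun S i =>
    if isOpen c i then
      (coins.getD i ⟨0, []⟩).arcs.foldl (fun S xy => if mem S xy.1 then S ||| (1 <<< xy.2) else S) S
    else S) S

/-- `n`-fold iteration of `step`. -/
def iter (coins : List Coin) (c : Nat) : Nat → Nat → Nat
  | 0, S => S
  | n + 1, S => iter coins c n (step coins c S)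

/-- Forward closure of `v` (`v` included) in the configuration `c`; `n` steps suffice on `n` vertices. -/
def reach (coins : List Coin) (n c v : Nat) : Nat := iter coins c n (1 <<< v)

/-- Product weight of the configuration `c` in units of `den^{-#coins}`. -/
def wt (coins : List Coin) (den c : Nat) : Nat :=
  (List.range coins.length).foldl
    (fun acc i => acc * (if isOpen c i then (coins.getD i ⟨0, []⟩).w else den - (coins.getD i ⟨0, []⟩).w)) 1

/-- Total mass of an indicator over all `2^#coins` configurations. -/
def mass (coins : List Coin) (den : Nat) (f : Nat → Bool) : Nat :=
  (List.range (2 ^ coins.length)).foldl (fun a c => if f c then a + wt coins den c else a) 0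

/-! ## Witness (a): the BASE row fails for a two-arc coin -/

/-- Coin `0 = {s→a, b→t}`, coin `1 = {s→b}`; `s = 0, a = 1, b = 2, t = 3`; both weights `1/2`. -/
def coinsA : List Coin := [⟨1, [(0, 1), (2, 3)]⟩, ⟨1, [(0, 2)]⟩]

/-- `R = {s ↛ t}`. -/
def RA (c : Nat) : Bool := !(mem (reach coinsA 4 c 0) 3)
/-- `X = 1[a ∈ S⁺]`. -/
def XA (c : Nat) : Bool := mem (reach coinsA 4 c 0) 1
/-- `Y = 1[b ∈ S⁺]`. -/
def YA (c : Nat) : Bool := mem (reach coinsA 4 c 0) 2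

/-- `4 · P(R) = 3`. -/
theorem massA_R : mass coinsA 2 RA = 3 := by decide +kernel
/-- `4 · E[X; R] = 1`. -/
theorem massA_XR : mass coinsA 2 (fun c => RA c && XA c) = 1 := by decide +kernel
/-- `4 · E[Y; R] = 1`. -/
theorem massA_YR : mass coinsA 2 (fun c => RA c && YA c) = 1 := by decide +kernel
/-- `4 · E[XY; R] = 0`. -/
theorem massA_XYR : mass coinsA 2 (fun c => RA c && XA c && YA c) = 0 := by decide +kernel

/-- `Cov(X, Y | s ↛ t) = −1/9 < 0`: directed BHK 1.3 fails for a coin system with a two-arc coin. -/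
theorem base_fails :
    ((mass coinsA 2 (fun c => RA c && XA c && YA c) : ℚ) / mass coinsA 2 RA)
      - (mass coinsA 2 (fun c => RA c && XA c) / mass coinsA 2 RA)
        * (mass coinsA 2 (fun c => RA c && YA c) / mass coinsA 2 RA) = -1 / 9 := by
  rw [massA_R, massA_XR, massA_YR, massA_XYR]; norm_num

/-! ## Witness (b): the free-arc gate fails while the BASE row holds -/

/-- Eight coins on six vertices, weights `k/8`; four two-arc coins. -/
def coinsB : List Coin :=
  [⟨6, [(1, 4)]⟩, ⟨6, [(4, 0), (3, 2)]⟩, ⟨5, [(5, 0), (5, 4)]⟩, ⟨6, [(1, 5)]⟩,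
   ⟨2, [(5, 3)]⟩, ⟨2, [(3, 1), (0, 1)]⟩, ⟨6, [(1, 3), (5, 1)]⟩, ⟨3, [(1, 0), (4, 3)]⟩]

/-- The root `s = 4` (`T = {1}`, `a = 0`, `b = 3`, free arc `u = 2 → w = 5`). -/
def sB : Nat := 4
/-- The single target vertex `t = 1`. -/
def tB : Nat := 1
/-- The marker `a = 0`. -/
def aB : Nat := 0
/-- The marker `b = 3`. -/
def bB : Nat := 3
/-- The tail `u = 2` of the free arc. -/
def uB : Nat := 2
/-- The head `w = 5` of the free arc. -/
def wB : Nat := 5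

/-- `R = {s ↛ t}`. -/
def RB (c : Nat) : Bool := !(mem (reach coinsB 6 c sB) tB)
/-- `X = 1[a ∈ S⁺]`. -/
def XB (c : Nat) : Bool := mem (reach coinsB 6 c sB) aB
/-- `Y = 1[b ∈ S⁺]`. -/
def YB (c : Nat) : Bool := mem (reach coinsB 6 c sB) bB
/-- `Q = {u ∈ S⁺ ∧ w ⇝ t} ∩ R`: the arc `u → w` is pivotal. -/
def QB (c : Nat) : Bool := RB c && mem (reach coinsB 6 c sB) uB && mem (reach coinsB 6 c wB) tB
/-- `E = R ∖ Q = {s ↛ t in D + (u → w)}`. -/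
def EB (c : Nat) : Bool := RB c && !(QB c)

/-- `8^8 · P(R)`. -/
theorem massB_R : mass coinsB 8 RB = 13238272 := by decide +kernel
/-- `8^8 · E[X; R]`. -/
theorem massB_XR : mass coinsB 8 (fun c => RB c && XB c) = 9437184 := by decide +kernel
/-- `8^8 · E[Y; R]`. -/
theorem massB_YR : mass coinsB 8 (fun c => RB c && YB c) = 4718592 := by decide +kernel
/-- `8^8 · E[XY; R]`. -/
theorem massB_XYR : mass coinsB 8 (fun c => RB c && XB c && YB c) = 3538944 := by decide +kernel
/-- `8^8 · P(E)`. -/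
theorem massB_E : mass coinsB 8 EB = 10584064 := by decide +kernel
/-- `8^8 · E[X; E]`. -/
theorem massB_XE : mass coinsB 8 (fun c => EB c && XB c) = 6782976 := by decide +kernel
/-- `8^8 · E[Y; E]`. -/
theorem massB_YE : mass coinsB 8 (fun c => EB c && YB c) = 2064384 := by decide +kernel
/-- `8^8 · E[XY; E]`. -/
theorem massB_XYE : mass coinsB 8 (fun c => EB c && XB c && YB c) = 884736 := by decide +kernel
/-- `8^8 · P(Q)`. -/
theorem massB_Q : mass coinsB 8 QB = 2654208 := by decide +kernel

/-- The BASE row holds on witness (b): `Cov(X, Y | R) = 135/10201 > 0` (so `Φ(R) = P(R)·Cov = 135/12928`). -/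
theorem base_holds_B :
    ((mass coinsB 8 (fun c => RB c && XB c && YB c) : ℚ) / mass coinsB 8 RB)
      - (mass coinsB 8 (fun c => RB c && XB c) / mass coinsB 8 RB)
        * (mass coinsB 8 (fun c => RB c && YB c) / mass coinsB 8 RB) = 135 / 10201 := by
  rw [massB_R, massB_XR, massB_YR, massB_XYR]; norm_num

/-- The pivotal event is not empty: `P(Q) = 81/512`. -/
theorem probQ_B : (mass coinsB 8 QB : ℚ) / 8 ^ 8 = 81 / 512 := by
  rw [massB_Q]; norm_num

/-- The free-arc gate functional is NEGATIVE on witness (b): with `m = E[· | R]`,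
`Φ(E) = E[(X − m_X)(Y − m_Y); E] = −98145/5222912 < 0`. -/
theorem free_arc_fails :
    let PR : ℚ := mass coinsB 8 RB
    let mX : ℚ := mass coinsB 8 (fun c => RB c && XB c) / PR
    let mY : ℚ := mass coinsB 8 (fun c => RB c && YB c) / PR
    (mass coinsB 8 (fun c => EB c && XB c && YB c) - mX * mass coinsB 8 (fun c => EB c && YB c)
      - mY * mass coinsB 8 (fun c => EB c && XB c) + mX * mY * mass coinsB 8 EB) / 8 ^ 8
      = -98145 / 5222912 := by
  intro PR mX mY
  simp only [PR, mX, mY]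
  rw [massB_R, massB_XR, massB_YR, massB_E, massB_XE, massB_YE, massB_XYE]; norm_num

end Summit.Ventures.PercRepro2.CoinScope
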